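import Literature.Geometry.Kaehler.IrreducibleComponentsProofs
import HarnessLib

/-!
# Regular points of a union of analytic sets; regular points of codimension `0`

Small complements to the dimension theory of analytic subsets of a complex manifold
(`Literature/Geometry/Kaehler/AnalyticSet*.lean`, [Chirka1989, §2.3, §5.3]), needed to say that a
lower bound on the codimension of analytic sets is inherited by finite unions ("`codim (S ∪ S') =
min (codim S, codim S')`", the codimension of an analytic set being read at its regular points,
`Literature.Geometry.Kaehler.regularLocus` / `IsRegularPointOfCodim`), and that proper analytic
subsets of a connected manifold have codimension `≥ 1`:

* `IsRegularPointOfCodim.of_union` — a regular point of codimension `q` of `S ∪ S'` (`S` analytic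
  at the point, `S'` closed) is a regular point of codimension `q` of `S` or of `S'`: the identity
  principle at a regular point (`exists_nhds_inter_subset_of_mem_closure`, [Chirka1989, §5.3]) shows
  that `S ∪ S'` coincides with `S` or with `S'` near the point; whence
  `regularLocus_union_subset` and `forall_regularLocus_union_le` (lower bounds on the codimension
  at regular points pass to `S ∪ S'`);
* `isRegularPointOfCodim_univ_zero`, `IsRegularPointOfCodim.mem_interior` — codimension `0` means
  "interior point"; hence on a connected complex manifold a proper analytic subset has all its
  regular points of codimension `≥ 1` (`IsAnalyticSet.one_le_of_ne_univ`, by the identity theorem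
  `IsAnalyticSet.interior_eq_empty_holds`, [Chirka1989, §2.2]), and conversely an analytic subset
  with that property is proper as soon as `M` is non-empty (`ne_univ_of_forall_regularLocus_one_le`).

Consumer: `Literature/AlgebraicGeometry/HodgeTheory/AnalyticSupport.lean` (sums of analytically
supported cohomology classes; the `p = 1` dictionary with the `S ≠ univ` phrasing of
`lefschetzOneOne_rational_of`). Theorems only; no new definitions or named facts.

## References

* E. M. Chirka, *Complex Analytic Sets*, Kluwer (1989), §2.2 Prop. 1, §2.3, §5.3 Cor. 2
  [Chirka1989].
* C. Voisin, *Hodge Theory and Complex Algebraic Geometry I* (CUP 2002), §11.1.1, Cor. 11.10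
  [VoisinHodgeI2002].
-/

open scoped Manifold ContDiff Topology
open Set Filter

namespace Literature.Geometry.Kaehler

variable {E : Type*} [NormedAddCommGroup E] [NormedSpace ℂ E]
  {H : Type*} [TopologicalSpace H] {I : ModelWithCorners ℂ E H}
  {M : Type*} [TopologicalSpace M] [ChartedSpace H M]

/-! ### Regular points of codimension `0` -/

/-- Every point of `M` is a regular point of codimension `0` of the whole space `univ` (no
equations: `m = 0`, the differential to `ℂ⁰` is trivially onto). [folklore] -/
theorem isRegularPointOfCodim_univ_zero (x : M) :
    IsRegularPointOfCodim I (univ : Set M) 0 x := by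
  refine ⟨univ, isOpen_univ, mem_univ x, fun _ => 0, mdifferentiableOn_const, ?_, ?_⟩
  · ext y
    simp
  · intro v
    exact ⟨0, Subsingleton.elim (α := Fin 0 → ℂ) _ _⟩

/-- Hence every point of `M` lies in the regular locus of `univ`. [folklore] -/
theorem regularLocus_univ : regularLocus I (univ : Set M) = univ :=
  eq_univ_of_forall fun x => ⟨mem_univ x, 0, isRegularPointOfCodim_univ_zero x⟩

/-- A regular point of codimension `0` of `Z` is an interior point of `Z` (no equations: `Z`
contains the whole neighbourhood carrying them). [folklore] -/
theorem IsRegularPointOfCodim.mem_interior {Z : Set M} {x : M} (h : IsRegularPointOfCodim I Z 0 x) :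
    x ∈ interior Z := by
  obtain ⟨U, hU, hxU, f, -, hZU, -⟩ := h
  have hfU : U ∩ f ⁻¹' {0} = U := by
    refine inter_eq_left.2 fun y _ => ?_
    simp only [mem_preimage, mem_singleton_iff]
    exact Subsingleton.elim _ _
  rw [hfU] at hZU
  exact interior_maximal (fun y hy => (hZU.symm.subset hy).1) hU hxU

/-- Conversely an interior point of `Z` is a regular point of codimension `0` of `Z`
(take `U = interior Z` and no equations). [folklore] -/
theorem isRegularPointOfCodim_zero_of_mem_interior {Z : Set M} {x : M} (hx : x ∈ interior Z) :
    IsRegularPointOfCodim I Z 0 x := by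
  refine ⟨interior Z, isOpen_interior, hx, fun _ => 0, mdifferentiableOn_const, ?_, ?_⟩
  · ext y
    constructor
    · rintro ⟨-, hy⟩
      exact ⟨hy, mem_singleton _⟩
    · rintro ⟨hy, -⟩
      exact ⟨interior_subset hy, hy⟩
  · intro v
    exact ⟨0, Subsingleton.elim (α := Fin 0 → ℂ) _ _⟩

/-- **Proper analytic subsets of a connected complex manifold have codimension `≥ 1`**: every
regular point of an analytic `Z ≠ M` has codimension `≥ 1`, since a regular point of codimension
`0` would be an interior point and `interior Z = ∅` by the identity theorem for analytic sets
(`IsAnalyticSet.interior_eq_empty_holds`). [cite: Chirka1989, §2.2 Prop. 1 and Corollary] -/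
theorem IsAnalyticSet.one_le_of_ne_univ [FiniteDimensional ℂ E] [IsManifold I 1 M] [I.Boundaryless]
    [ConnectedSpace M] {Z : Set M} (hZ : IsAnalyticSet I Z) (hZne : Z ≠ univ) :
    ∀ x ∈ regularLocus I Z, ∀ q : ℕ, IsRegularPointOfCodim I Z q x → 1 ≤ q := by
  intro x _ q hq
  rcases Nat.eq_zero_or_pos q with rfl | hq0
  · have hx : x ∈ interior Z := hq.mem_interior
    rw [IsAnalyticSet.interior_eq_empty_holds I M hZ hZne] at hx
    exact absurd hx (notMem_empty x)
  · exact hq0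

/-- Conversely, if all regular points of `Z` have codimension `≥ p` for some `0 < p`, then `Z ≠ M`
as soon as `M` is non-empty (every point of `M` is a regular point of codimension `0` of `univ`).
[folklore] -/
theorem ne_univ_of_forall_regularLocus_le [Nonempty M] {Z : Set M} {p : ℕ} (hp : 0 < p)
    (h : ∀ x ∈ regularLocus I Z, ∀ q : ℕ, IsRegularPointOfCodim I Z q x → p ≤ q) : Z ≠ univ := by
  rintro rfl
  obtain ⟨x⟩ := ‹Nonempty M›
  have h0 := h x ⟨mem_univ x, 0, isRegularPointOfCodim_univ_zero x⟩ 0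
    (isRegularPointOfCodim_univ_zero x)
  omega

/-! ### Regular points of a union -/

section Union

variable [FiniteDimensional ℂ E] [IsManifold I 1 M] [I.Boundaryless]

/-- **Regular points of a union.** Let `S, S' ⊆ M` with `S` analytic at `x` and `S'` closed, and
let `x` be a regular point of `S ∪ S'`, of codimension `q`. Then `x` is a regular point of
codimension `q` of `S` (and lies in `S`) or of `S'` (and lies in `S'`). Indeed either `x` is a
limit of points of `(S ∪ S') ∖ S'`, around each of which `S ∪ S'` lies in `S`, and then `S ∪ S'`
lies in `S` near `x` by the identity principle at the regular point `x`
(`exists_nhds_inter_subset_of_mem_closure`); or `S ∪ S'` lies in `S'` near `x`; in both cases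
regularity passes to the intermediate set (`IsRegularPointOfCodim.of_inter_subset`). In terms of
dimension: `dim_x (S ∪ S') = max (dim_x S, dim_x S')` (Voisin I, Cor. 11.10).
[cite: Chirka1989, §5.3 Cor. 2 (uniqueness theorem) with §2.3] -/
theorem IsRegularPointOfCodim.of_union {S S' : Set M} {q : ℕ} {x : M} (hS : IsAnalyticSetAt I S x)
    (hS' : IsClosed S') (hx : x ∈ regularLocus I (S ∪ S'))
    (hq : IsRegularPointOfCodim I (S ∪ S') q x) :
    (x ∈ S ∧ IsRegularPointOfCodim I S q x) ∨ (x ∈ S' ∧ IsRegularPointOfCodim I S' q x) := by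
  by_cases hcl : x ∈ closure ((S ∪ S') \ S')
  · left
    have hcl' : x ∈ closure {z ∈ S ∪ S' | ∃ N ∈ 𝓝 z, (S ∪ S') ∩ N ⊆ S} := by
      refine closure_mono ?_ hcl
      rintro z ⟨hz, hzS'⟩
      exact ⟨hz, S'ᶜ, hS'.isOpen_compl.mem_nhds hzS', fun w hw => hw.1.resolve_right hw.2⟩
    obtain ⟨N, hN, hNS⟩ := exists_nhds_inter_subset_of_mem_closure hx hS hcl'
    exact ⟨hNS ⟨hx.1, mem_of_mem_nhds hN⟩,
      hq.of_inter_subset isOpen_interior (mem_interior_iff_mem_nhds.2 hN)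
        ((inter_subset_inter_right _ interior_subset).trans hNS) subset_union_left⟩
  · right
    rw [mem_closure_iff_nhds] at hcl
    push Not at hcl
    obtain ⟨V, hV, hVe⟩ := hcl
    have hsub : (S ∪ S') ∩ interior V ⊆ S' := by
      intro w hw
      by_contra hwS'
      have hw' : w ∈ V ∩ ((S ∪ S') \ S') := ⟨interior_subset hw.2, hw.1, hwS'⟩
      rw [hVe] at hw'
      exact hw'
    exact ⟨hsub ⟨hx.1, mem_interior_iff_mem_nhds.2 hV⟩,
      hq.of_inter_subset isOpen_interior (mem_interior_iff_mem_nhds.2 hV) hsub subset_union_right⟩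

/-- The regular locus of a union of two analytic sets lies in the union of their regular loci.
[cite: Chirka1989, §5.3 Cor. 2 with §2.3] -/
theorem regularLocus_union_subset {S S' : Set M} (hS : IsAnalyticSet I S) (hS' : IsAnalyticSet I S') :
    regularLocus I (S ∪ S') ⊆ regularLocus I S ∪ regularLocus I S' := by
  intro x hx
  obtain ⟨hxZ, q, hq⟩ := hx
  rcases hq.of_union (hS x) hS'.isClosed ⟨hxZ, q, hq⟩ with ⟨hxS, h⟩ | ⟨hxS', h⟩
  · exact Or.inl ⟨hxS, q, h⟩
  · exact Or.inr ⟨hxS', q, h⟩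

/-- **Lower bounds on the codimension pass to unions**: if all regular points of the analytic sets
`S` and `S'` have codimension `≥ p`, so do all regular points of `S ∪ S'`
("`codim (S ∪ S') = min (codim S, codim S')`"). [cite: Chirka1989, §5.3 Cor. 2 with §2.3] -/
theorem forall_regularLocus_union_le {S S' : Set M} {p : ℕ} (hS : IsAnalyticSet I S)
    (hS' : IsAnalyticSet I S')
    (hp : ∀ x ∈ regularLocus I S, ∀ q : ℕ, IsRegularPointOfCodim I S q x → p ≤ q)
    (hp' : ∀ x ∈ regularLocus I S', ∀ q : ℕ, IsRegularPointOfCodim I S' q x → p ≤ q) :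
    ∀ x ∈ regularLocus I (S ∪ S'), ∀ q : ℕ, IsRegularPointOfCodim I (S ∪ S') q x → p ≤ q := by
  intro x hx q hq
  rcases hq.of_union (hS x) hS'.isClosed hx with ⟨hxS, h⟩ | ⟨hxS', h⟩
  · exact hp x ⟨hxS, q, h⟩ q h
  · exact hp' x ⟨hxS', q, h⟩ q h

/-- `Finset`-indexed version: a lower bound on the codimension at regular points shared by
finitely many analytic sets passes to their union. [cite: Chirka1989, §5.3 Cor. 2 with §2.3] -/
theorem forall_regularLocus_biUnion_finset_le {ι : Type*} (s : Finset ι) {S : ι → Set M} {p : ℕ}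
    (hS : ∀ i ∈ s, IsAnalyticSet I (S i))
    (hp : ∀ i ∈ s, ∀ x ∈ regularLocus I (S i), ∀ q : ℕ, IsRegularPointOfCodim I (S i) q x → p ≤ q) :
    ∀ x ∈ regularLocus I (⋃ i ∈ s, S i), ∀ q : ℕ,
      IsRegularPointOfCodim I (⋃ i ∈ s, S i) q x → p ≤ q := by
  classical
  induction s using Finset.induction_on with
  | empty =>
    intro x hx
    simp only [Finset.notMem_empty, iUnion_of_empty, iUnion_empty] at hx
    exact absurd hx.1 (notMem_empty x)
  | insert a s ha ih =>
    have hu : (⋃ i ∈ insert a s, S i) = S a ∪ ⋃ i ∈ s, S i := Finset.set_biUnion_insert a s S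
    rw [hu]
    exact forall_regularLocus_union_le (hS a (Finset.mem_insert_self a s))
      (isAnalyticSet_biUnion_finset s fun i hi => hS i (Finset.mem_insert_of_mem hi))
      (hp a (Finset.mem_insert_self a s))
      (ih (fun i hi => hS i (Finset.mem_insert_of_mem hi))
        (fun i hi => hp i (Finset.mem_insert_of_mem hi)))

end Union

end Literature.Geometry.Kaehler
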